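/-
Copyright (c) 2026 the pub-hodgecm-mathlib formalisation cell (harness21).  Prover seat hodgecm-mathlib-K2E3-p11 (g3), Track B «K2-LIT» ∕ h413,
line `K2_E3_EllipticInputs`, unit U12 «Characters», socket #11 `sig_K2E3CharLocIntNearSemisimple`, road (11-PS): the IRREDUCIBLE principal series, packaged.  2026-09-04.
-/
import Summits.HodgeConjecture.HodgeConjecture.Theorems.K2E3CharLocIntPrincipalSeriesThree     -- ★ p856769 (this seat) FILE 3: `charLocIntNearSemisimple_of_equiv_cmPrincipalSeries`
import HarnessLib

/-!
# K2_E3 road (h413 = stmt-HodgeConjecture-24833), unit U12 «Characters», socket #11 — road (11-PS), FILE 5: THE CLASS OF AN IRREDUCIBLE PRINCIPAL SERIES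
# `i_G(χ)` OF `U(Φ₃)(L⁺_v)` (`v` non-split) SATISFIES SOCKET #11's CONCLUSION (Rogawski 1990 §12.2 p. 173, (4.9.4) p. 56; Harish-Chandra 1999 Thm. 16.1)

Cell `pub/hodgecm-mathlib` (D-0151), Track B, `--supports stmt-HodgeConjecture-24833 --as helper` (count-neutral); THEOREMS ONLY — no `def`, no instance, no notation,
no named fact, no `sorry`; ★-only imports.  Seat K2E3-p11 (g3).

THE POINT.  ★ FILE 3 `charLocIntNearSemisimple_of_equiv_cmPrincipalSeries` gives socket #11's conclusion for every class `⟦r⟧` with `r.ρ ≃ i_G(χ)`.  Here the class of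
`i_G(χ)` ITSELF is packaged when `i_G(χ)` is IRREDUCIBLE (e.g. a unitary `i_G(χ₁, χ₂)` off the `w`-fixed locus, ★ `isIrreducible_cmPrincipalSeries_of_cmWeylTorusCharPair_ne`;
[Rogawski1990 §12.2 p. 173]): `i_G(χ)` is smooth (★ `Representation.isSmooth_smoothInd`: it IS a smooth induction, ★ `normalizedInd`), so `⟨i_G(χ)⟩ : SmoothIrrep G` and
`Representation.Equiv.refl` feeds FILE 3.
* `isSmooth_cmPrincipalSeries`, **`charLocIntNearSemisimple_mk_cmPrincipalSeries`**.

HONEST LABEL: HC_CM is proved only modulo the 7 printed citations (2 remaining named inputs: hLiu418 = stmt-HodgeConjecture-24832, h413 = stmt-HodgeConjecture-24833)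
until rung 0 closes; count-neutral helper (row #11 stays OPEN).

## References
* [Rogawski1990] J. D. Rogawski, *Automorphic Representations of Unitary Groups in Three Variables*, Ann. of Math. Stud. 123 (1990), §12.2 p. 173, §4.9 (4.9.4) p. 56.
* [HarishChandra1999] Harish-Chandra (notes by S. DeBacker, P. J. Sally), *Admissible Invariant Distributions on Reductive p-adic Groups*, ULS 16 (1999), Thm. 16.1 p. 77.
* [BernsteinZelevinsky1976] I. N. Bernstein, A. V. Zelevinsky, *Representations of the group GL(n,F) where F is a non-archimedean local field* (1976), §2.21 (smooth induction).
-/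

set_option autoImplicit false
-- the mandated namespace has the single-problem summit's repeated segment (`HodgeConjecture.HodgeConjecture`)
set_option linter.dupNamespace false

noncomputable section

open MeasureTheory Measure Set Filter Topology Function NumberField IsDedekindDomain
open Literature.NumberTheory.Automorphic Literature.NumberTheory.Automorphic.UnitaryGroup Literature.NumberTheory.Rogawski1990
open scoped ENNReal NNReal MatrixGroups

namespace Summit.HodgeConjecture.HodgeConjecture.Cruxes.H413.K2E3CharLocIntIrreduciblePrincipalSeries

variable (L : Type) [Field L] [NumberField L] [IsCMField L] (v : HeightOneSpectrum (𝓞 ↥(maximalRealSubfield L)))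

/-- **`i_G(χ)` is a smooth representation** (it is the smooth induction ★ `normalizedInd` = ★ `smoothIndRep`, smooth by ★ `Representation.isSmooth_smoothInd`).
[cite: BernsteinZelevinsky1976, §2.21] [cite: Rogawski1990, §12.2 p. 173] -/
theorem isSmooth_cmPrincipalSeries (χ : ↥(cmBorelTriple L 3 v).M →* ℂˣ) :
    (UnitaryGroup.cmPrincipalSeries L 3 v χ).IsSmooth := by
  haveI := locallyCompactSpace_cmBorelU L 3 v
  unfold UnitaryGroup.cmPrincipalSeries UnitaryGroup.principalSeries Representation.normalizedInd
  exact Representation.isSmooth_smoothInd (cmBorelTriple L 3 v).P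
    (Representation.twist ((((Representation.trivial ℂ ↥(cmBorelTriple L 3 v).M ℂ).twist χ).comp (cmBorelTriple L 3 v).proj))
      (rootDeltaChar (cmBorelTriple L 3 v).P))

set_option maxHeartbeats 400000 in
/-- **SOCKET #11 FOR THE CLASS OF AN IRREDUCIBLE PRINCIPAL SERIES** (`G = U(Φ₃)(L⁺_v) = Gqs L v`, `v` non-split, `χ` continuous, `i_G(χ)` irreducible): with
`r := ⟨i_G(χ)⟩`, the class `⟦r⟧` satisfies socket #11's conclusion token for token at every `s` — ★ FILE 3 at `Representation.Equiv.refl`.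
[cite: Rogawski1990, §12.2 p. 173; §4.9 (4.9.4) p. 56] [cite: HarishChandra1999, Thm. 16.1 p. 77] -/
theorem charLocIntNearSemisimple_mk_cmPrincipalSeries
    (hns : ∀ w : PlacesOver L v, IsCMField.complexConj L • w.1 = w.1)
    [MeasurableSpace (Gqs L v)] [BorelSpace (Gqs L v)] (μ : Measure (Gqs L v)) [μ.IsHaarMeasure]
    (χ : ↥(cmBorelTriple L 3 v).M →* ℂˣ) (hχ : Continuous fun t => ((χ t : ℂˣ) : ℂ))
    (hirr : (UnitaryGroup.cmPrincipalSeries L 3 v χ).IsIrreducible) :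
    ∀ s : Gqs L v,
      Module.End.IsSemisimple (Matrix.toLin' ((s.val : GL (Fin 3) (UnitaryGroup.LocalRing L v)).val : Matrix (Fin 3) (Fin 3) (UnitaryGroup.LocalRing L v))) →
        ∃ U : Set (Gqs L v), IsOpen U ∧ s ∈ U ∧
          ∃ Θ : Gqs L v → ℂ, IntegrableOn Θ U μ ∧
            ∀ f : Gqs L v → ℂ, f ∈ SchwartzBruhat (Gqs L v) → tsupport f ⊆ U →
              (IrrClass.mk (G := Gqs L v)
                  ({ V := _, ρ := UnitaryGroup.cmPrincipalSeries L 3 v χ, isIrreducible := hirr, isSmooth := isSmooth_cmPrincipalSeries L v χ } :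
                    SmoothIrrep (Gqs L v))).smoothTrace μ f = ∫ g, f g * Θ g ∂μ :=
  K2E3CharLocIntPrincipalSeriesThree.charLocIntNearSemisimple_of_equiv_cmPrincipalSeries L v hns μ χ hχ _ _ rfl (Representation.Equiv.refl _)

end Summit.HodgeConjecture.HodgeConjecture.Cruxes.H413.K2E3CharLocIntIrreduciblePrincipalSeries

end
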